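import Summits.KontsevichZagierPeriods.KontsevichZagierPeriods.Theorems.LinRedNormalFormArrangementNormalFormSeparateTwoChart

/-!
# Planar weights: power counting integrals and local integrability infrastructure

(Line `janus-bands`, crux `ArrangementNormalForm`, stub `stub_separateTwoZero` — separation in a
good rational direction for PLANAR arrangement representations without fibres; part `Weights`.)

The two planar integrals of the POWER COUNTING at a vertex: the weight `(|u| + |λ|)⁻¹` is
integrable on the unit square (`integrableOn_inv_abs_add`, AM–GM domination by
`|u|^{-1/2}|λ|^{-1/2}`), and `|u|^D/|u|^M` is integrable on a sector at the origin only if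
`M < D + 2` (`lt_of_integrableOn_sector`, registered as `separateTwoZero_weights`; Tonelli in the
linear chart `SepTwo.lintegral_chartProd`). Infrastructure: boxes, the Taylor pieces `piece` in a
chart, boundedness off the pole line (`core_away`), local-to-global (`integrableOn_of_forall_nhds`).
-/

noncomputable section

open Set MeasureTheory Filter Topology
open scoped ENNReal

namespace Summit.KontsevichZagierPeriods.ArrangementNormalForm.JanusBands

namespace SepTwoZero

/-- `|t|^{-1/2}` is integrable on `(-1, 1)`. -/
theorem integrableOn_abs_rpow_neg_half :
    IntegrableOn (fun t : ℝ => |t| ^ (-(1 / 2) : ℝ)) (Ioo (-1) 1) := by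
  have hpos : IntegrableOn (fun t : ℝ => |t| ^ (-(1 / 2) : ℝ)) (Ioo 0 1) := by
    refine ((intervalIntegral.integrableOn_Ioo_rpow_iff zero_lt_one).2
      (by norm_num : (-1 : ℝ) < -(1 / 2))).congr_fun (fun t ht => ?_) measurableSet_Ioo
    rw [abs_of_pos ht.1]
  have hneg : IntegrableOn (fun t : ℝ => |t| ^ (-(1 / 2) : ℝ)) (Ioo (-1) 0) := by
    have hpre : (Neg.neg : ℝ → ℝ) ⁻¹' Ioo (-1) 0 = Ioo 0 1 := by ext t; simp
    refine ((Measure.measurePreserving_neg (volume : Measure ℝ)).integrableOn_comp_preimage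
      (Homeomorph.neg ℝ).measurableEmbedding).1 ?_
    rw [hpre]
    exact hpos.congr_fun (fun t _ => by simp) measurableSet_Ioo
  have h : Ioo (-1 : ℝ) 1 ⊆ Ioc (-1) 0 ∪ Ioo 0 1 := fun t ht => by
    rcases le_or_gt t 0 with h | h
    · exact Or.inl ⟨ht.1, h⟩
    · exact Or.inr ⟨h, ht.2⟩
  exact ((integrableOn_Ioc_iff_integrableOn_Ioo (f := fun t : ℝ => |t| ^ (-(1 / 2) : ℝ))).2
    hneg |>.union hpos).mono_set h

/-- AM–GM in the form `(|u| + |λ|)⁻¹ ≤ |u|^{-1/2} |λ|^{-1/2}` (`u, λ ≠ 0`). -/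
theorem inv_add_le_rpow {u l : ℝ} (hu : u ≠ 0) (hl : l ≠ 0) :
    (|u| + |l|)⁻¹ ≤ |u| ^ (-(1 / 2) : ℝ) * |l| ^ (-(1 / 2) : ℝ) := by
  have hu' : 0 < |u| := abs_pos.2 hu
  have hl' : 0 < |l| := abs_pos.2 hl
  rw [Real.rpow_neg hu'.le, Real.rpow_neg hl'.le, ← mul_inv, ← Real.sqrt_eq_rpow,
    ← Real.sqrt_eq_rpow]
  refine inv_anti₀ (by positivity) ?_
  rw [← Real.sqrt_mul hu'.le]
  calc √(|u| * |l|) ≤ √((|u| + |l|) ^ 2) := Real.sqrt_le_sqrt (by nlinarith)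
    _ = |u| + |l| := Real.sqrt_sq (by positivity)

/-- **The planar weight `(|u| + |λ|)⁻¹` is integrable on the unit square.** -/
theorem integrableOn_inv_abs_add :
    IntegrableOn (fun w : ℝ × ℝ => (|w.1| + |w.2|)⁻¹) (Ioo (-1) 1 ×ˢ Ioo (-1) 1) := by
  have h1 := integrableOn_abs_rpow_neg_half
  have h2 : Integrable (fun w : ℝ × ℝ => |w.1| ^ (-(1 / 2) : ℝ) * |w.2| ^ (-(1 / 2) : ℝ))
      (volume.restrict (Ioo (-1 : ℝ) 1 ×ˢ Ioo (-1 : ℝ) 1)) := by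
    have := Integrable.mul_prod h1 h1
    rwa [Measure.prod_restrict, ← Measure.volume_eq_prod] at this
  refine Integrable.mono' h2 ?_ ?_
  · exact (Measurable.inv (by fun_prop)).aestronglyMeasurable
  · have hnull : volume ({w : ℝ × ℝ | w.1 = 0} ∪ {w | w.2 = 0}) = 0 := by
      refine measure_union_null ?_ ?_
      · have : {w : ℝ × ℝ | w.1 = 0} = ({0} : Set ℝ) ×ˢ (univ : Set ℝ) := by
          ext w; simp
        rw [this, Measure.volume_eq_prod, Measure.prod_prod]; simp
      · have : {w : ℝ × ℝ | w.2 = 0} = (univ : Set ℝ) ×ˢ ({0} : Set ℝ) := by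
          ext w; simp
        rw [this, Measure.volume_eq_prod, Measure.prod_prod]; simp
    have hae : ∀ᵐ w ∂(volume : Measure (ℝ × ℝ)), w ∉ ({w : ℝ × ℝ | w.1 = 0} ∪ {w | w.2 = 0}) :=
      measure_eq_zero_iff_ae_notMem.1 hnull
    filter_upwards [ae_restrict_of_ae hae] with w hw
    simp only [mem_union, mem_setOf_eq, not_or] at hw
    rw [Real.norm_eq_abs, abs_inv, abs_of_nonneg (by positivity)]
    exact inv_add_le_rpow hw.1 hw.2

/-- `t⁻¹` is not integrable at `0⁺`. -/
theorem not_integrableOn_inv_Ioo {δ : ℝ} (hδ : 0 < δ) :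
    ¬ IntegrableOn (fun t : ℝ => t⁻¹) (Ioo 0 δ) := by
  intro h
  have h' : IntegrableOn (fun t : ℝ => t ^ (-1 : ℝ)) (Ioo 0 δ) :=
    h.congr_fun (fun t _ => by rw [Real.rpow_neg_one]) measurableSet_Ioo
  have := (intervalIntegral.integrableOn_Ioo_rpow_iff hδ).1 h'
  norm_num at this

/-- `∫⁻ |u|⁻¹` over a one-sided neighbourhood of `0` is infinite. -/
theorem lintegral_inv_side {δ σ : ℝ} (hδ : 0 < δ) (hσ : σ = 1 ∨ σ = -1) :
    ∫⁻ u in {u : ℝ | σ * u ∈ Ioo 0 δ}, ENNReal.ofReal |u|⁻¹ = ∞ := by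
  have hpos : ∫⁻ u in Ioo (0 : ℝ) δ, ENNReal.ofReal |u|⁻¹ = ∞ := by
    by_contra hne
    refine not_integrableOn_inv_Ioo hδ ⟨?_, ?_⟩
    · exact (continuousOn_inv₀.mono fun t ht => ne_of_gt ht.1).aestronglyMeasurable
        measurableSet_Ioo
    · rw [hasFiniteIntegral_iff_enorm]
      refine lt_top_iff_ne_top.2 fun htop => hne ?_
      rw [← htop]
      refine setLIntegral_congr_fun measurableSet_Ioo fun u hu => ?_
      rw [Real.enorm_eq_ofReal_abs, abs_inv]
  rcases hσ with rfl | rfl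
  · have hset : {u : ℝ | 1 * u ∈ Ioo 0 δ} = Ioo 0 δ := by ext u; simp
    rw [hset, hpos]
  · have hset : {u : ℝ | -1 * u ∈ Ioo 0 δ} = Neg.neg ⁻¹' Ioo 0 δ := by
      ext u; simp only [neg_mul, one_mul, mem_setOf_eq, mem_preimage]
    rw [hset, ← hpos, ← (Measure.measurePreserving_neg (volume : Measure ℝ)).setLIntegral_comp_preimage_emb
      (Homeomorph.neg ℝ).measurableEmbedding]
    simp

/-- **Power counting on a sector (divergence).** If `|u|^D / |u|^M` is integrable on the sector
`{σ u ∈ (0, δ), λ/u ∈ (m₁, m₂)}` at the origin, then `M < D + 2`. -/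
theorem lt_of_integrableOn_sector {D M : ℕ} {δ m₁ m₂ σ : ℝ} (hδ : 0 < δ) (hm : m₁ < m₂)
    (hσ : σ = 1 ∨ σ = -1)
    (h : IntegrableOn (fun w : ℝ × ℝ => |w.1| ^ D / |w.1| ^ M)
      {w | σ * w.1 ∈ Ioo 0 δ ∧ w.2 / w.1 ∈ Ioo m₁ m₂}) : M < D + 2 := by
  by_contra hM
  push Not at hM
  have hσ0 : ∀ u : ℝ, σ * u ∈ Ioo 0 (min δ 1) → u ≠ 0 ∧ |u| ≤ 1 := by
    intro u hu
    rcases hσ with rfl | rfl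
    · simp only [one_mul] at hu
      exact ⟨ne_of_gt hu.1, by rw [abs_of_pos hu.1]; exact hu.2.le.trans (min_le_right _ _)⟩
    · simp only [neg_mul, one_mul] at hu
      refine ⟨fun h0 => by simp [h0] at hu, ?_⟩
      rw [abs_of_neg (by linarith [hu.1])]
      exact hu.2.le.trans (min_le_right _ _)
  set I := {u : ℝ | σ * u ∈ Ioo 0 (min δ 1)} with hI
  have hIm : MeasurableSet I := measurableSet_Ioo.preimage (measurable_const_mul σ)
  set S' := {w : ℝ × ℝ | w.1 ∈ I ∧ (w.2 - (fun _ : ℝ => (0 : ℝ)) w.1) / id w.1 ∈ Ioo m₁ m₂}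
    with hS'
  have hsub : S' ⊆ {w | σ * w.1 ∈ Ioo 0 δ ∧ w.2 / w.1 ∈ Ioo m₁ m₂} := by
    rintro w ⟨hw1, hw2⟩
    refine ⟨⟨hw1.1, hw1.2.trans_le (min_le_left _ _)⟩, by simpa using hw2⟩
  have h' := h.mono_set hsub
  set f : ℝ × ℝ → ℝ := fun w => |w.1| ^ D / |w.1| ^ M with hf
  have hfm : Measurable f := by fun_prop
  have hchart := SepTwo.lintegral_chartProd (J := Ioo m₁ m₂) (b := fun _ : ℝ => (0 : ℝ))
    (c := id) hIm measurableSet_Ioo measurable_const measurable_id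
    (fun u hu => (hσ0 u hu).1) (fun w => ‖f w‖ₑ) hfm.enorm
  have hfin : ∫⁻ w in S', ‖f w‖ₑ < ∞ := h'.2
  rw [hchart] at hfin
  -- lower bound of the inner integral
  have hlow : ∀ u ∈ I, ENNReal.ofReal (m₂ - m₁) * ENNReal.ofReal |u|⁻¹ ≤
      ENNReal.ofReal |id u| * ∫⁻ v in Ioo m₁ m₂, ‖f (u, (fun _ : ℝ => (0 : ℝ)) u + id u * v)‖ₑ := by
    intro u hu
    obtain ⟨hu0, hu1⟩ := hσ0 u hu
    have hup : 0 < |u| := abs_pos.2 hu0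
    simp only [id, hf, lintegral_const, Measure.restrict_apply MeasurableSet.univ, univ_inter,
      Real.volume_Ioo]
    rw [Real.enorm_eq_ofReal (by positivity), mul_comm (ENNReal.ofReal (|u| ^ D / |u| ^ M)),
      ← mul_assoc, mul_comm (ENNReal.ofReal |u|), mul_assoc, ← ENNReal.ofReal_mul hup.le]
    gcongr
    rw [mul_div_assoc', ← pow_succ', le_div_iff₀ (pow_pos hup _)]
    obtain ⟨K, rfl⟩ : ∃ K, M = D + 2 + K := ⟨M - (D + 2), by omega⟩
    rw [show D + 2 + K = 1 + (D + 1) + K by ring, pow_add, pow_add, pow_one, mul_assoc,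
      ← mul_assoc |u|⁻¹, inv_mul_cancel₀ (ne_of_gt hup), one_mul]
    exact mul_le_of_le_one_right (pow_nonneg hup.le _) (pow_le_one₀ hup.le hu1)
  have hge : ENNReal.ofReal (m₂ - m₁) * ∫⁻ u in I, ENNReal.ofReal |u|⁻¹ ≤
      ∫⁻ u in I, ENNReal.ofReal |id u| *
        ∫⁻ v in Ioo m₁ m₂, ‖f (u, (fun _ : ℝ => (0 : ℝ)) u + id u * v)‖ₑ := by
    rw [← lintegral_const_mul' _ _ ENNReal.ofReal_ne_top]
    exact setLIntegral_mono' hIm hlow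
  rw [lintegral_inv_side (lt_min hδ one_pos) hσ, ENNReal.mul_top (by simpa using hm)] at hge
  exact absurd (top_le_iff.1 hge ▸ hfin) (lt_irrefl _)

/-! ### Local integrability infrastructure on the plane -/

section Infra

/-- The open box `{|u| < ρ, |λ| < ρ}`. -/
def box (ρ : ℝ) : Set (ℝ × ℝ) := {w | |w.1| < ρ ∧ |w.2| < ρ}

/-- The box is a product of intervals. -/
theorem box_eq (ρ : ℝ) : box ρ = Ioo (-ρ) ρ ×ˢ Ioo (-ρ) ρ := by
  ext w; simp [box, abs_lt, and_assoc]

/-- The box is measurable. -/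
theorem measurableSet_box (ρ : ℝ) : MeasurableSet (box ρ) := by
  rw [box_eq]; exact measurableSet_Ioo.prod measurableSet_Ioo

/-- A product of bounded intervals has finite area. -/
theorem volume_prod_Ioo_lt_top (a b c d : ℝ) : volume (Ioo a b ×ˢ Ioo c d) < ∞ := by
  rw [Measure.volume_eq_prod, Measure.prod_prod]
  simp [Real.volume_Ioo, ENNReal.mul_lt_top]

/-- A bounded measurable function is integrable on a measurable set of finite measure. -/
theorem integrableOn_of_bdd {f : ℝ × ℝ → ℝ} (hf : Measurable f) {t : Set (ℝ × ℝ)}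
    (ht : MeasurableSet t) (hfin : volume t < ∞) {C : ℝ} (hb : ∀ w ∈ t, |f w| ≤ C) :
    IntegrableOn f t :=
  Measure.integrableOn_of_bounded (M := C) hfin.ne hf.aestronglyMeasurable
    ((ae_restrict_iff' ht).2 (Eventually.of_forall fun w hw => by
      rw [Real.norm_eq_abs]; exact hb w hw))

/-- The `i`-th Taylor piece in the chart: `qᵢ(u)/(u^E W₁(u)) · λ^i/λ^n`. -/
def piece (Q : ℕ → ℝ → ℝ) (W₁ : ℝ → ℝ) (E n i : ℕ) (w : ℝ × ℝ) : ℝ :=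
  Q i w.1 / (w.1 ^ E * W₁ w.1) * (w.2 ^ i / w.2 ^ n)

/-- The Taylor pieces are measurable. -/
theorem measurable_piece {Q : ℕ → ℝ → ℝ} {W₁ : ℝ → ℝ} (hQ : ∀ i, Continuous (Q i))
    (hW : Continuous W₁) (E n i : ℕ) : Measurable (piece Q W₁ E n i) := by
  unfold piece
  have h1 : Measurable fun w : ℝ × ℝ => Q i w.1 := (hQ i).measurable.comp measurable_fst
  have h2 : Measurable fun w : ℝ × ℝ => W₁ w.1 := hW.measurable.comp measurable_fst
  fun_prop

/-- Continuity bounds for the regular wall factor `W₁` near `0`. -/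
theorem W_bounds {W₁ : ℝ → ℝ} (hW : Continuous W₁) (hW0 : W₁ 0 ≠ 0) :
    ∃ ρW > 0, ∃ CW > 0, ρW ≤ 1 ∧ ∀ u : ℝ, |u| < ρW → |W₁ 0| / 2 ≤ |W₁ u| ∧ |W₁ u| ≤ CW := by
  have hev : ∀ᶠ u in 𝓝 (0 : ℝ), |W₁ 0| / 2 < |W₁ u| ∧ |W₁ u| < |W₁ 0| + 1 := by
    have ht : Tendsto (fun u => |W₁ u|) (𝓝 0) (𝓝 |W₁ 0|) := hW.abs.tendsto 0
    exact (ht.eventually_const_lt (by linarith [abs_pos.2 hW0])).and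
      (ht.eventually_lt_const (by linarith))
  obtain ⟨ρ, hρ, hb⟩ := Metric.eventually_nhds_iff.1 hev
  refine ⟨min ρ 1, by positivity, |W₁ 0| + 1, by positivity, min_le_right _ _, fun u hu => ?_⟩
  have := hb (show dist u 0 < ρ by simpa using hu.trans_le (min_le_left _ _))
  exact ⟨this.1.le, this.2.le⟩

/-- **Local integrability off the pole line** (no wall through the point): every Taylor piece
is bounded near `(0, λ₀)`, `λ₀ ≠ 0` (or no pole at all). -/
theorem core_away {s : Set (ℝ × ℝ)} (hs : MeasurableSet s) {Q : ℕ → ℝ → ℝ}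
    (hQ : ∀ i, Continuous (Q i)) (W₁ : ℝ → ℝ) (hW : Continuous W₁) (hW0 : W₁ 0 ≠ 0)
    (n i : ℕ) (l₀ : ℝ) (hl : n ≠ 0 → l₀ ≠ 0) :
    ∃ ρ > 0, IntegrableOn (piece Q W₁ 0 n i) (s ∩ {w | |w.1| < ρ ∧ |w.2 - l₀| < ρ}) := by
  obtain ⟨ρW, hρW, CW, -, hρW1, hWb⟩ := W_bounds hW hW0
  obtain ⟨CQ, hCQ⟩ := isCompact_Icc.exists_bound_of_continuousOn
    ((hQ i).continuousOn (s := Icc (-1 : ℝ) 1))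
  set ρ₂ : ℝ := if n = 0 then 1 else |l₀| / 2 with hρ₂
  have hρ₂pos : 0 < ρ₂ := by
    rw [hρ₂]; split_ifs with h
    · exact one_pos
    · exact half_pos (abs_pos.2 (hl h))
  set ρ := min ρW ρ₂ with hρ
  have hρpos : 0 < ρ := lt_min hρW hρ₂pos
  have hρ1 : ρ ≤ 1 := (min_le_left _ _).trans hρW1
  set Lb := |l₀| + 1 with hLb
  have hW00 : 0 < |W₁ 0| := abs_pos.2 hW0
  refine ⟨ρ, hρpos, integrableOn_of_bdd (measurable_piece hQ hW 0 n i) (hs.inter ?_) ?_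
    (C := CQ * (2 / |W₁ 0|) * (Lb ^ i * (2 / |l₀|) ^ n)) (fun w hw => ?_)⟩
  · exact (measurableSet_lt (measurable_fst.abs) measurable_const).inter
      (measurableSet_lt ((measurable_snd.sub measurable_const).abs) measurable_const)
  · refine (measure_mono (show s ∩ {w : ℝ × ℝ | |w.1| < ρ ∧ |w.2 - l₀| < ρ} ⊆
      Ioo (-ρ) ρ ×ˢ Ioo (l₀ - ρ) (l₀ + ρ) from fun w hw => ?_)).trans_lt
      (volume_prod_Ioo_lt_top _ _ _ _)
    obtain ⟨-, h1, h2⟩ := hw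
    rw [abs_lt] at h1 h2
    exact ⟨⟨by linarith, by linarith⟩, ⟨by linarith, by linarith⟩⟩
  obtain ⟨-, hw1, hw2⟩ := hw
  have hQb : |Q i w.1| ≤ CQ := by
    have := hCQ w.1 (by rw [mem_Icc, ← abs_le]; exact hw1.le.trans hρ1)
    rwa [Real.norm_eq_abs] at this
  have hCQ0 : 0 ≤ CQ := (abs_nonneg _).trans hQb
  have hWl := (hWb w.1 (hw1.trans_le (min_le_left _ _))).1
  have hl2 : |w.2| ≤ Lb := by
    have := abs_sub_abs_le_abs_sub w.2 l₀; rw [hLb]; linarith [hw2.trans_le hρ1]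
  have hfrac : |w.2| ^ i / |w.2| ^ n ≤ Lb ^ i * (2 / |l₀|) ^ n := by
    rcases Nat.eq_zero_or_pos n with hn | hn
    · simp only [hn, pow_zero, div_one, mul_one]
      exact pow_le_pow_left₀ (abs_nonneg _) hl2 _
    · have hl0 : 0 < |l₀| := abs_pos.2 (hl hn.ne')
      have hρl : ρ ≤ |l₀| / 2 := by
        rw [hρ, hρ₂, if_neg hn.ne']; exact min_le_right _ _
      have hlow : |l₀| / 2 ≤ |w.2| := by
        have := abs_sub_abs_le_abs_sub l₀ w.2
        rw [abs_sub_comm] at this; linarith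
      rw [div_eq_mul_inv, ← inv_pow]
      refine mul_le_mul (pow_le_pow_left₀ (abs_nonneg _) hl2 _) (pow_le_pow_left₀
        (by positivity) ?_ _) (by positivity) (by positivity)
      have hw2pos : 0 < |w.2| := by linarith
      rw [← one_div, le_div_iff₀ hl0, one_div, inv_mul_le_iff₀ hw2pos]
      linarith
  simp only [piece, pow_zero, one_mul, abs_mul, abs_div, abs_pow]
  calc |Q i w.1| / |W₁ w.1| * (|w.2| ^ i / |w.2| ^ n)
      ≤ CQ / (|W₁ 0| / 2) * (Lb ^ i * (2 / |l₀|) ^ n) := by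
        refine mul_le_mul ?_ hfrac (by positivity) (by positivity)
        exact div_le_div₀ hCQ0 hQb (by positivity) hWl
    _ = CQ * (2 / |W₁ 0|) * (Lb ^ i * (2 / |l₀|) ^ n) := by
        congr 1; field_simp

/-- **Local-to-global**: a function locally integrable on a bounded set near every point of
its closure is integrable on the set. -/
theorem integrableOn_of_forall_nhds {X : Type*} [TopologicalSpace X] [MeasurableSpace X]
    {μ : Measure X} {f : X → ℝ} {s : Set X}
    (hs : IsCompact (closure s))
    (h : ∀ z ∈ closure s, ∃ U : Set X, IsOpen U ∧ z ∈ U ∧ IntegrableOn f (s ∩ U) μ) :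
    IntegrableOn f s μ := by
  choose U hUo hUz hUi using h
  obtain ⟨t, ht⟩ := hs.elim_finite_subcover (fun z : closure s => U z.1 z.2) (fun z => hUo z.1 z.2)
    fun z hz => mem_iUnion.2 ⟨⟨z, hz⟩, hUz z hz⟩
  have hcov : s ⊆ ⋃ z ∈ t, s ∩ U z.1 z.2 := fun z hz => by
    obtain ⟨i, hi⟩ := mem_iUnion.1 (ht (subset_closure hz))
    obtain ⟨hit, hzi⟩ := mem_iUnion.1 hi
    exact mem_iUnion₂.2 ⟨i, hit, hz, hzi⟩
  exact (integrableOn_finset_iUnion.2 fun z _ => hUi z.1 z.2).mono_set hcov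

end Infra

end SepTwoZero

open SepTwoZero in
/-- **Power counting on a sector** (registered sub-goal of `stub_separateTwoZero`): if `|u|^D / |u|^M` is integrable on the sector `{σ u ∈ (0, δ), λ/u ∈ (m₁, m₂)}`, then `M < D + 2`. -/
theorem separateTwoZero_weights (D M : ℕ) (δ m₁ m₂ σ : ℝ) (hδ : 0 < δ) (hm : m₁ < m₂) (hσ : σ = 1 ∨ σ = -1) (h : MeasureTheory.IntegrableOn (fun w : ℝ × ℝ => |w.1| ^ D / |w.1| ^ M) {w : ℝ × ℝ | σ * w.1 ∈ Set.Ioo 0 δ ∧ w.2 / w.1 ∈ Set.Ioo m₁ m₂}) : M < D + 2 := by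
  exact lt_of_integrableOn_sector hδ hm hσ h

end Summit.KontsevichZagierPeriods.ArrangementNormalForm.JanusBands
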